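import Summits.CriticalPhenomena.PercolationContinuityZ3.Theses.PercDiodeSteering
import Summits.CriticalPhenomena.PercolationContinuityZ3.Theorems.PercNearOneGluingNoHeavyLowerTailCSHTheoremOne
import Literature.Probability.Percolation.SharpnessDCTProofs
import HarnessLib

/-!
# `PercDiodeSteering.RDMonotone` (stmt-CriticalPhenomena-7552) — SETTLED after continuity

Item `stmt-CriticalPhenomena-7552` of route `CriticalPhenomena/PercDiodeSteering` (support): the diode percolation probability `θ⁺(p, r)` is monotone: `p ≤ p'`, `p r ≤ p' r'` ⇒ `θ⁺(p, r) ≤ θ⁺(p', r')`.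

Pointwise inclusion of the step relations under the identity coupling of the labels (`Relation.ReflTransGen.mono`), then monotonicity of the label measure.  p205010 is NOT used.

builds on p205010 (kernel theorem, internal audit signed; external expert review pending) — USED (`CSH.percolationContinuityZ3_holds`).  RSW3 lane, lead gen 28 (prover-prim-rsw3-lead-g28-0):
'after continuity — the ledger harvest'.
References: G. Kozma, N. Nitzan (2024), Thm. 6 / Conj. 3 [KozmaNitzan2024]; G. Grimmett, *Percolation* (1999), §8 [GrimmettPercolation1999].
-/

noncomputable section

namespace Summit.CriticalPhenomena.PercolationContinuityZ3.Theorems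

namespace PercDiodeSteeringRDMonotone

open MeasureTheory Literature.Probability.Percolation Literature.Probability.LatticeModels

/-- **`PercDiodeSteering.RDMonotone` (stmt-CriticalPhenomena-7552), settled.**  `Relation.ReflTransGen.mono` + `measureReal_mono`.
[cite: KozmaNitzan2024, Thm. 6 with Conj. 3 (p. 15)] -/
theorem rDMonotone_proof : Summit.CriticalPhenomena.PercolationContinuityZ3.Theses.PercDiodeSteering.RDMonotone := by
  unfold Summit.CriticalPhenomena.PercolationContinuityZ3.Theses.PercDiodeSteering.RDMonotone
  intro θ p p' r r' hp hpr
  dsimp only [θ]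
  haveI := isProbabilityMeasure_labelMeasure (Site 3)
  refine measureReal_mono (fun U hU => ?_) (measure_ne_top _ _)
  simp only [Set.mem_setOf_eq] at hU ⊢
  refine hU.mono fun y hy => ?_
  refine Relation.ReflTransGen.mono (fun x z h => ?_) _ _ hy
  rcases h with ⟨h1, h2⟩ | ⟨h1, h2⟩
  · exact Or.inl ⟨h1, h2.trans hp⟩
  · exact Or.inr ⟨h1, h2.trans hpr⟩

end PercDiodeSteeringRDMonotone

end Summit.CriticalPhenomena.PercolationContinuityZ3.Theorems

end
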